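import Mathlib
import HarnessLib

/-!
# Lemmas for the true non-radiative kernel elements: parity-graded `t`-polynomials and power bounds

Analysis/PDE support file (everything proved): re-indexing and evaluation at `t = 0` of the
parity-graded `t`-polynomials `Σ_i t^{2i+ν} a_i` (`ν ∈ {0,1}`), crude power bounds for chain
functions `a_i ≈ c_i z^{γ_i}`, the pointwise `z⁻²` decay of the energy density of such a polynomial
on `{z > 1+|t|}` when `|a_i| ≲ z^{γ₀−2i}`, `γ₀ + ν ≤ 0`, and the pointwise bounds behind the
data-closeness and data-energy integrals. Used by `TrueKernelElement.lean` (route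
PhotonSphereChannels, `FixedModeChannels`, far side, stmt-FinalStateConjecture-10048). Folklore.
-/

noncomputable section

namespace Literature.Analysis.PDE

open MeasureTheory Set Filter Topology Finset Real

/-- Re-indexing a parity-graded `t`-polynomial as an ordinary one:
`Σ_{i ≤ j} t^{2i+ν} a_i = Σ_{k < 2j+ν+1} A_k t^k` with `A_k = Σ_i [2i+ν = k] a_i`. [folklore] -/
theorem sum_parity_monomials_eq (a : ℕ → ℝ) (j ν : ℕ) (t : ℝ) :
    ∑ i ∈ range (j + 1), t ^ (2 * i + ν) * a i
      = ∑ k ∈ range (2 * j + ν + 1),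
          (∑ i ∈ range (j + 1), if 2 * i + ν = k then a i else 0) * t ^ k := by
  simp_rw [Finset.sum_mul]
  rw [Finset.sum_comm]
  refine Finset.sum_congr rfl fun i hi => ?_
  have hi' : 2 * i + ν < 2 * j + ν + 1 := by have := mem_range.1 hi; omega
  rw [Finset.sum_eq_single (2 * i + ν)]
  · simp [mul_comm]
  · intro k _ hk; simp [Ne.symm hk]
  · intro h; exact absurd (mem_range.2 hi') h

/-- Evaluating a parity-graded `t`-polynomial at `t = 0`: only `i = 0`, `ν = 0` survives.
[folklore] -/
theorem sum_zero_pow_parity (b : ℕ → ℝ) (j : ℕ) {ν : ℕ} (hν : ν ≤ 1) :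
    ∑ i ∈ range (j + 1), (0 : ℝ) ^ (2 * i + ν) * b i = (1 - ν) * b 0 := by
  rw [Finset.sum_eq_single 0]
  · rcases Nat.le_one_iff_eq_zero_or_eq_one.1 hν with h | h <;> subst h <;> simp
  · intro i _ hi
    have : 2 * i + ν ≠ 0 := by omega
    simp [zero_pow this]
  · simp

/-- Evaluating the `t`-derivative of a parity-graded `t`-polynomial at `t = 0`: only `i = 0`,
`ν = 1` survives. [folklore] -/
theorem sum_zero_pow_parity_deriv (b : ℕ → ℝ) (j : ℕ) {ν : ℕ} (hν : ν ≤ 1) :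
    ∑ i ∈ range (j + 1), ((2 * i + ν : ℕ) : ℝ) * (0 : ℝ) ^ (2 * i + ν - 1) * b i = ν * b 0 := by
  rw [Finset.sum_eq_single 0]
  · rcases Nat.le_one_iff_eq_zero_or_eq_one.1 hν with h | h <;> subst h <;> simp
  · intro i _ hi
    have : 2 * i + ν - 1 ≠ 0 := by omega
    simp [zero_pow this]
  · simp

/-- Crude power bounds for a chain function from its closeness to `c z^γ`. [folklore] -/
theorem chain_crude_bounds {f f' : ℝ → ℝ} {c γ K ε G : ℝ} (hK : 0 ≤ K) (hε1 : ε ≤ 1)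
    (hc : |c| ≤ K) (hγ : |γ| ≤ G) {z : ℝ} (hz : 1 ≤ z)
    (h0 : |f z - c * z ^ γ| ≤ K * ε * z ^ (γ - 1 / 2))
    (h1 : |f' z - c * γ * z ^ (γ - 1)| ≤ K * ε * z ^ (γ - 3 / 2)) :
    |f z| ≤ 2 * K * z ^ γ ∧ |f' z| ≤ (G + 1) * K * z ^ (γ - 1) := by
  have hz0 : 0 < z := by linarith
  have hmono : ∀ a b : ℝ, a ≤ b → z ^ a ≤ z ^ b := fun a b hab =>
    rpow_le_rpow_of_exponent_le hz hab
  have hzγ : 0 ≤ z ^ γ := rpow_nonneg hz0.le _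
  have hzγ1 : 0 ≤ z ^ (γ - 1) := rpow_nonneg hz0.le _
  have hG : 0 ≤ G := (abs_nonneg _).trans hγ
  constructor
  · calc |f z| = |(f z - c * z ^ γ) + c * z ^ γ| := by ring_nf
      _ ≤ |f z - c * z ^ γ| + |c * z ^ γ| := abs_add_le _ _
      _ ≤ K * ε * z ^ (γ - 1 / 2) + K * z ^ γ := by
          refine add_le_add h0 ?_
          rw [abs_mul, abs_of_nonneg hzγ]; exact mul_le_mul_of_nonneg_right hc hzγ
      _ ≤ K * 1 * z ^ γ + K * z ^ γ :=
          add_le_add (mul_le_mul (mul_le_mul_of_nonneg_left hε1 hK) (hmono _ _ (by linarith))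
            (rpow_nonneg hz0.le _) (by positivity)) le_rfl
      _ = 2 * K * z ^ γ := by ring
  · calc |f' z| = |(f' z - c * γ * z ^ (γ - 1)) + c * γ * z ^ (γ - 1)| := by ring_nf
      _ ≤ |f' z - c * γ * z ^ (γ - 1)| + |c * γ * z ^ (γ - 1)| := abs_add_le _ _
      _ ≤ K * ε * z ^ (γ - 3 / 2) + K * G * z ^ (γ - 1) := by
          refine add_le_add h1 ?_
          rw [abs_mul, abs_mul, abs_of_nonneg hzγ1]
          exact mul_le_mul_of_nonneg_right (mul_le_mul hc hγ (abs_nonneg _) hK) hzγ1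
      _ ≤ K * 1 * z ^ (γ - 1) + K * G * z ^ (γ - 1) :=
          add_le_add (mul_le_mul (mul_le_mul_of_nonneg_left hε1 hK) (hmono _ _ (by linarith))
            (rpow_nonneg hz0.le _) (by positivity)) le_rfl
      _ = (G + 1) * K * z ^ (γ - 1) := by ring

/-- **Pointwise energy decay of a `t`-polynomial with decaying coefficients.** If on `z ≥ 7/8`
`p = Σ_{i≤j} t^{2i+ν} a_i`, `∂_t p = Σ (2i+ν) t^{2i+ν−1} a_i`, `∂_z p = Σ t^{2i+ν} a_i'`, with
`|a_i| ≤ L z^{γ₀−2i}`, `|a_i'| ≤ L z^{γ₀−2i−1}` (`z ≥ 1`), `γ₀ + ν ≤ 0`, `2j + ν ≤ 2n + 2` and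
`0 ≤ W ≤ (n²+n+1) z⁻²` on `z ≥ 1`, then `e_W[p](t,z) ≤ C z⁻²` on `{z > 1 + |t|}`. [folklore] -/
theorem truePoly_energy_pointwise {W : ℝ → ℝ} {p : ℝ → ℝ → ℝ} {a a' : ℕ → ℝ → ℝ} {j ν n : ℕ}
    {γ₀ L : ℝ} (hL : 0 ≤ L) (hγν : γ₀ + ν ≤ 0) (hjn : 2 * j + ν ≤ 2 * n + 2)
    (hW : ∀ z, 1 ≤ z → W z ≤ ((n : ℝ) ^ 2 + n + 1) * z ^ (-(2 : ℝ)))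
    (hp : ∀ t z, (7 / 8 : ℝ) ≤ z → p t z = ∑ i ∈ range (j + 1), t ^ (2 * i + ν) * a i z)
    (hpt : ∀ t z, (1 : ℝ) ≤ z → deriv (fun τ => p τ z) t
      = ∑ i ∈ range (j + 1), ((2 * i + ν : ℕ) : ℝ) * t ^ (2 * i + ν - 1) * a i z)
    (hpz : ∀ t z, (1 : ℝ) ≤ z → deriv (p t) z = ∑ i ∈ range (j + 1), t ^ (2 * i + ν) * a' i z)
    (ha : ∀ i, i ≤ j → ∀ z, 1 ≤ z → |a i z| ≤ L * z ^ (γ₀ - 2 * i))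
    (ha' : ∀ i, i ≤ j → ∀ z, 1 ≤ z → |a' i z| ≤ L * z ^ (γ₀ - 2 * i - 1)) :
    ∀ t z, 1 + |t| < z → deriv (fun τ => p τ z) t ^ 2 + deriv (p t) z ^ 2 + W z * p t z ^ 2
      ≤ ((((j : ℝ) + 1) * ((2 * n + 2) * L)) ^ 2 + (((j : ℝ) + 1) * L) ^ 2
          + ((n : ℝ) ^ 2 + n + 1) * (((j : ℝ) + 1) * L) ^ 2) * z ^ (-(2 : ℝ)) := by
  intro t z hz
  have ht0 : 0 ≤ |t| := abs_nonneg t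
  have hz1 : 1 ≤ z := by linarith
  have hz0 : 0 < z := by linarith
  have htz : |t| ≤ z := by linarith
  have hmono : ∀ a b : ℝ, a ≤ b → z ^ a ≤ z ^ b := fun a b hab =>
    rpow_le_rpow_of_exponent_le hz1 hab
  have hpowt : ∀ k : ℕ, |t| ^ k ≤ z ^ k := fun k => pow_le_pow_left₀ ht0 htz k
  have hcard : ((range (j + 1)).card : ℝ) = j + 1 := by simp
  -- |p| ≤ (j+1) L
  have hp_bd : |p t z| ≤ ((j : ℝ) + 1) * L := by
    rw [hp t z (by linarith)]
    calc |∑ i ∈ range (j + 1), t ^ (2 * i + ν) * a i z|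
        ≤ ∑ i ∈ range (j + 1), |t ^ (2 * i + ν) * a i z| := abs_sum_le_sum_abs _ _
      _ ≤ ∑ i ∈ range (j + 1), L := by
          refine Finset.sum_le_sum fun i hi => ?_
          have hij : i ≤ j := Nat.lt_succ_iff.1 (mem_range.1 hi)
          rw [abs_mul, abs_pow]
          calc |t| ^ (2 * i + ν) * |a i z| ≤ z ^ (2 * i + ν) * (L * z ^ (γ₀ - 2 * i)) :=
                mul_le_mul (hpowt _) (ha i hij z hz1) (abs_nonneg _) (by positivity)
            _ = L * (z ^ (((2 * i + ν : ℕ) : ℝ)) * z ^ (γ₀ - 2 * i)) := by rw [rpow_natCast]; ring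
            _ = L * z ^ (γ₀ + ν) := by
                rw [← rpow_add hz0]; congr 1; congr 1; push_cast; ring
            _ ≤ L * 1 := mul_le_mul_of_nonneg_left
                ((hmono _ _ hγν).trans (by rw [rpow_zero])) hL
            _ = L := mul_one _
      _ = ((j : ℝ) + 1) * L := by rw [Finset.sum_const, nsmul_eq_mul, hcard]
  -- |p_t| ≤ (j+1)(2n+2) L z⁻¹
  have hpt_bd :
      |deriv (fun τ => p τ z) t| ≤ ((j : ℝ) + 1) * ((2 * n + 2) * L) * z ^ (-(1 : ℝ)) := by
    rw [hpt t z hz1]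
    calc |∑ i ∈ range (j + 1), ((2 * i + ν : ℕ) : ℝ) * t ^ (2 * i + ν - 1) * a i z|
        ≤ ∑ i ∈ range (j + 1), |((2 * i + ν : ℕ) : ℝ) * t ^ (2 * i + ν - 1) * a i z| :=
          abs_sum_le_sum_abs _ _
      _ ≤ ∑ i ∈ range (j + 1), (2 * n + 2) * L * z ^ (-(1 : ℝ)) := by
          refine Finset.sum_le_sum fun i hi => ?_
          have hij : i ≤ j := Nat.lt_succ_iff.1 (mem_range.1 hi)
          rcases Nat.eq_zero_or_pos (2 * i + ν) with hk | hk
          · rw [hk]; simp only [Nat.cast_zero, zero_mul, abs_zero]; positivity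
          · rw [abs_mul, abs_mul, abs_pow, Nat.abs_cast]
            have hkle : ((2 * i + ν : ℕ) : ℝ) ≤ 2 * n + 2 := by
              have : 2 * i + ν ≤ 2 * n + 2 := by omega
              exact_mod_cast this
            calc ((2 * i + ν : ℕ) : ℝ) * |t| ^ (2 * i + ν - 1) * |a i z|
                ≤ (2 * n + 2) * z ^ (2 * i + ν - 1) * (L * z ^ (γ₀ - 2 * i)) := by
                  refine mul_le_mul (mul_le_mul hkle (hpowt _) (by positivity) (by positivity))
                    (ha i hij z hz1) (abs_nonneg _) (by positivity)
              _ = (2 * n + 2) * L * (z ^ (((2 * i + ν - 1 : ℕ) : ℝ)) * z ^ (γ₀ - 2 * i)) := by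
                  rw [rpow_natCast]; ring
              _ = (2 * n + 2) * L * z ^ (γ₀ + ν - 1) := by
                  rw [← rpow_add hz0]; congr 1; congr 1
                  rw [Nat.cast_sub (by omega : 1 ≤ 2 * i + ν)]; push_cast; ring
              _ ≤ (2 * n + 2) * L * z ^ (-(1 : ℝ)) :=
                  mul_le_mul_of_nonneg_left (hmono _ _ (by linarith)) (by positivity)
      _ = ((j : ℝ) + 1) * ((2 * n + 2) * L) * z ^ (-(1 : ℝ)) := by
          rw [Finset.sum_const, nsmul_eq_mul, hcard]; ring
  -- |p_z| ≤ (j+1) L z⁻¹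
  have hpz_bd : |deriv (p t) z| ≤ ((j : ℝ) + 1) * L * z ^ (-(1 : ℝ)) := by
    rw [hpz t z hz1]
    calc |∑ i ∈ range (j + 1), t ^ (2 * i + ν) * a' i z|
        ≤ ∑ i ∈ range (j + 1), |t ^ (2 * i + ν) * a' i z| := abs_sum_le_sum_abs _ _
      _ ≤ ∑ i ∈ range (j + 1), L * z ^ (-(1 : ℝ)) := by
          refine Finset.sum_le_sum fun i hi => ?_
          have hij : i ≤ j := Nat.lt_succ_iff.1 (mem_range.1 hi)
          rw [abs_mul, abs_pow]
          calc |t| ^ (2 * i + ν) * |a' i z| ≤ z ^ (2 * i + ν) * (L * z ^ (γ₀ - 2 * i - 1)) :=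
                mul_le_mul (hpowt _) (ha' i hij z hz1) (abs_nonneg _) (by positivity)
            _ = L * (z ^ (((2 * i + ν : ℕ) : ℝ)) * z ^ (γ₀ - 2 * i - 1)) := by
                rw [rpow_natCast]; ring
            _ = L * z ^ (γ₀ + ν - 1) := by
                rw [← rpow_add hz0]; congr 1; congr 1; push_cast; ring
            _ ≤ L * z ^ (-(1 : ℝ)) := mul_le_mul_of_nonneg_left (hmono _ _ (by linarith)) hL
      _ = ((j : ℝ) + 1) * L * z ^ (-(1 : ℝ)) := by
          rw [Finset.sum_const, nsmul_eq_mul, hcard]; ring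
  -- squares
  have hz2 : z ^ (-(1 : ℝ)) * z ^ (-(1 : ℝ)) = z ^ (-(2 : ℝ)) := by
    rw [← rpow_add hz0]; norm_num
  have sq1 : deriv (fun τ => p τ z) t ^ 2
      ≤ (((j : ℝ) + 1) * ((2 * n + 2) * L)) ^ 2 * z ^ (-(2 : ℝ)) := by
    have h := hpt_bd
    have h0 : 0 ≤ ((j : ℝ) + 1) * ((2 * n + 2) * L) * z ^ (-(1 : ℝ)) := by positivity
    calc deriv (fun τ => p τ z) t ^ 2 = |deriv (fun τ => p τ z) t| ^ 2 := (sq_abs _).symm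
      _ ≤ (((j : ℝ) + 1) * ((2 * n + 2) * L) * z ^ (-(1 : ℝ))) ^ 2 :=
          pow_le_pow_left₀ (abs_nonneg _) h 2
      _ = (((j : ℝ) + 1) * ((2 * n + 2) * L)) ^ 2 * z ^ (-(2 : ℝ)) := by rw [← hz2]; ring
  have sq2 : deriv (p t) z ^ 2 ≤ (((j : ℝ) + 1) * L) ^ 2 * z ^ (-(2 : ℝ)) := by
    calc deriv (p t) z ^ 2 = |deriv (p t) z| ^ 2 := (sq_abs _).symm
      _ ≤ (((j : ℝ) + 1) * L * z ^ (-(1 : ℝ))) ^ 2 := pow_le_pow_left₀ (abs_nonneg _) hpz_bd 2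
      _ = (((j : ℝ) + 1) * L) ^ 2 * z ^ (-(2 : ℝ)) := by rw [← hz2]; ring
  have sq3 :
      W z * p t z ^ 2 ≤ ((n : ℝ) ^ 2 + n + 1) * (((j : ℝ) + 1) * L) ^ 2 * z ^ (-(2 : ℝ)) := by
    have h1 : p t z ^ 2 ≤ (((j : ℝ) + 1) * L) ^ 2 := by
      calc p t z ^ 2 = |p t z| ^ 2 := (sq_abs _).symm
        _ ≤ (((j : ℝ) + 1) * L) ^ 2 := pow_le_pow_left₀ (abs_nonneg _) hp_bd 2
    calc W z * p t z ^ 2 ≤ (((n : ℝ) ^ 2 + n + 1) * z ^ (-(2 : ℝ))) * (((j : ℝ) + 1) * L) ^ 2 :=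
          mul_le_mul (hW z hz1) h1 (sq_nonneg _) (by positivity)
      _ = ((n : ℝ) ^ 2 + n + 1) * (((j : ℝ) + 1) * L) ^ 2 * z ^ (-(2 : ℝ)) := by ring
  linarith [sq1, sq2, sq3]

/-- Pointwise bound for the data-closeness integrand of a kernel element. [folklore] -/
theorem trueKernel_closeness_pointwise {a0 a0' Pz γ₀ K ε : ℝ} {ν n : ℕ} (hν : ν ≤ 1)
    (hγ₀ : γ₀ ≤ 0) (hγ₁ : ν = 1 → γ₀ ≤ -1) {z : ℝ} (hz : 1 ≤ z)
    (d0 : |a0 - z ^ γ₀| ≤ K * ε * z ^ (γ₀ - 1 / 2))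
    (d1 : |a0' - γ₀ * z ^ (γ₀ - 1)| ≤ K * ε * z ^ (γ₀ - 3 / 2))
    (hP : Pz ≤ ((n : ℝ) ^ 2 + n + 1) * z ^ (-(2 : ℝ))) :
    ((1 - ν) * a0' - (1 - ν) * γ₀ * z ^ (γ₀ - 1)) ^ 2 + Pz * ((1 - ν) * a0 - (1 - ν) * z ^ γ₀) ^ 2
        + (ν * a0 - ν * z ^ γ₀) ^ 2
      ≤ K ^ 2 * ((n : ℝ) ^ 2 + n + 2) * ε ^ 2 * z ^ (-(3 : ℝ)) := by
  have hz0 : 0 < z := by linarith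
  have hmono : ∀ a b : ℝ, a ≤ b → z ^ a ≤ z ^ b := fun a b hab =>
    rpow_le_rpow_of_exponent_le hz hab
  have hKε : 0 ≤ K * ε := by
    have := (abs_nonneg _).trans d0
    rcases (mul_nonneg_iff_of_pos_right (rpow_pos_of_pos hz0 (γ₀ - 1 / 2))).1 this with h
    exact h
  have hsq : ∀ (x e : ℝ), |x| ≤ K * ε * z ^ e → x ^ 2 ≤ (K * ε) ^ 2 * z ^ (2 * e) := by
    intro x e h
    calc x ^ 2 = |x| ^ 2 := (sq_abs _).symm
      _ ≤ (K * ε * z ^ e) ^ 2 := pow_le_pow_left₀ (abs_nonneg _) h 2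
      _ = (K * ε) ^ 2 * (z ^ e) ^ 2 := by ring
      _ = (K * ε) ^ 2 * z ^ (2 * e) := by
          rw [← rpow_natCast (z ^ e) 2, ← rpow_mul hz0.le]; push_cast; ring_nf
  have e0 := hsq _ _ d0
  have e1 := hsq _ _ d1
  have hz3 : 0 ≤ z ^ (-(3 : ℝ)) := rpow_nonneg hz0.le _
  rcases Nat.le_one_iff_eq_zero_or_eq_one.1 hν with h | h <;> subst h
  · simp only [Nat.cast_zero, sub_zero, one_mul, zero_mul, sub_self, zero_pow two_ne_zero, add_zero]
    have t1 : (a0' - γ₀ * z ^ (γ₀ - 1)) ^ 2 ≤ (K * ε) ^ 2 * z ^ (-(3 : ℝ)) :=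
      e1.trans (mul_le_mul_of_nonneg_left (hmono _ _ (by linarith)) (sq_nonneg _))
    have t2 : Pz * (a0 - z ^ γ₀) ^ 2 ≤ ((n : ℝ) ^ 2 + n + 1) * (K * ε) ^ 2 * z ^ (-(3 : ℝ)) := by
      calc Pz * (a0 - z ^ γ₀) ^ 2
          ≤ (((n : ℝ) ^ 2 + n + 1) * z ^ (-(2 : ℝ))) * ((K * ε) ^ 2 * z ^ (2 * (γ₀ - 1 / 2))) :=
            mul_le_mul hP e0 (sq_nonneg _) (by positivity)
        _ = ((n : ℝ) ^ 2 + n + 1) * (K * ε) ^ 2 * (z ^ (-(2 : ℝ)) * z ^ (2 * (γ₀ - 1 / 2))) := by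
            ring
        _ ≤ ((n : ℝ) ^ 2 + n + 1) * (K * ε) ^ 2 * z ^ (-(3 : ℝ)) := by
            refine mul_le_mul_of_nonneg_left ?_ (by positivity)
            rw [← rpow_add hz0]; exact hmono _ _ (by linarith)
    nlinarith [t1, t2, hz3, sq_nonneg (K * ε)]
  · simp only [Nat.cast_one, sub_self, zero_mul, one_mul, mul_zero, add_zero,
      zero_pow two_ne_zero, zero_add]
    have hγ := hγ₁ rfl
    have t3 : (a0 - z ^ γ₀) ^ 2 ≤ (K * ε) ^ 2 * z ^ (-(3 : ℝ)) :=
      e0.trans (mul_le_mul_of_nonneg_left (hmono _ _ (by linarith)) (sq_nonneg _))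
    nlinarith [t3, hz3, sq_nonneg (K * ε)]

/-- Pointwise bound for the data energy density of a kernel element. [folklore] -/
theorem trueKernel_energy_pointwise0 {a0 a0' Pz γ₀ K : ℝ} {ν n : ℕ} (hν : ν ≤ 1) (hK : 0 ≤ K)
    (hγ₀ : γ₀ ≤ 0) (hγ₁ : ν = 1 → γ₀ ≤ -1) {z : ℝ} (hz : 1 ≤ z)
    (b0 : |a0| ≤ 2 * K * z ^ γ₀) (b1 : |a0'| ≤ (2 * n + 2) * K * z ^ (γ₀ - 1))
    (hP : Pz ≤ ((n : ℝ) ^ 2 + n + 1) * z ^ (-(2 : ℝ))) :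
    (ν * a0) ^ 2 + ((1 - ν) * a0') ^ 2 + Pz * ((1 - ν) * a0) ^ 2
      ≤ ((2 * K) ^ 2 + ((2 * n + 2) * K) ^ 2 + ((n : ℝ) ^ 2 + n + 1) * (2 * K) ^ 2)
        * z ^ (-(2 : ℝ)) := by
  have hz0 : 0 < z := by linarith
  have hmono : ∀ a b : ℝ, a ≤ b → z ^ a ≤ z ^ b := fun a b hab =>
    rpow_le_rpow_of_exponent_le hz hab
  have hsq : ∀ (x M e : ℝ), 0 ≤ M → |x| ≤ M * z ^ e → x ^ 2 ≤ M ^ 2 * z ^ (2 * e) := by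
    intro x M e hM h
    calc x ^ 2 = |x| ^ 2 := (sq_abs _).symm
      _ ≤ (M * z ^ e) ^ 2 := pow_le_pow_left₀ (abs_nonneg _) h 2
      _ = M ^ 2 * (z ^ e) ^ 2 := by ring
      _ = M ^ 2 * z ^ (2 * e) := by
          rw [← rpow_natCast (z ^ e) 2, ← rpow_mul hz0.le]; push_cast; ring_nf
  have e0 := hsq _ _ _ (by positivity) b0
  have e1 := hsq _ _ _ (by positivity) b1
  have hz2 : 0 ≤ z ^ (-(2 : ℝ)) := rpow_nonneg hz0.le _
  have hzγ : z ^ (2 * γ₀) ≤ 1 := (hmono (2 * γ₀) 0 (by linarith)).trans (by rw [rpow_zero])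
  have t1 : a0' ^ 2 ≤ ((2 * n + 2) * K) ^ 2 * z ^ (-(2 : ℝ)) :=
    e1.trans (mul_le_mul_of_nonneg_left (hmono _ _ (by linarith)) (sq_nonneg _))
  have t2 : Pz * a0 ^ 2 ≤ ((n : ℝ) ^ 2 + n + 1) * (2 * K) ^ 2 * z ^ (-(2 : ℝ)) := by
    calc Pz * a0 ^ 2 ≤ (((n : ℝ) ^ 2 + n + 1) * z ^ (-(2 : ℝ))) * ((2 * K) ^ 2 * z ^ (2 * γ₀)) :=
          mul_le_mul hP e0 (sq_nonneg _) (by positivity)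
      _ ≤ (((n : ℝ) ^ 2 + n + 1) * z ^ (-(2 : ℝ))) * ((2 * K) ^ 2 * 1) := by gcongr
      _ = ((n : ℝ) ^ 2 + n + 1) * (2 * K) ^ 2 * z ^ (-(2 : ℝ)) := by ring
  rcases Nat.le_one_iff_eq_zero_or_eq_one.1 hν with h | h <;> subst h
  · simp only [Nat.cast_zero, zero_mul, sub_zero, one_mul, zero_pow two_ne_zero, zero_add]
    nlinarith [t1, t2, hz2, sq_nonneg (2 * K)]
  · simp only [Nat.cast_one, one_mul, sub_self, zero_mul, mul_zero, add_zero,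
      zero_pow two_ne_zero]
    have hγ := hγ₁ rfl
    have t0 : a0 ^ 2 ≤ (2 * K) ^ 2 * z ^ (-(2 : ℝ)) :=
      e0.trans (mul_le_mul_of_nonneg_left (hmono _ _ (by linarith)) (sq_nonneg _))
    nlinarith [t0, hz2, sq_nonneg ((2 * n + 2) * K), sq_nonneg (2 * K),
      sq_nonneg ((n : ℝ) ^ 2 + n + 1)]

end Literature.Analysis.PDE
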